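import Literature.MathematicalPhysics.QuantumFieldTheory.Balaban1983to89.Node00.Record13CarriersSepCoPR
import Literature.MathematicalPhysics.QuantumFieldTheory.Balaban1983to89.Node00.Record13CarriersB8SubBH

/-!
v1.6 `CoPR` IMAGE (KEY-RULE-25, node00-def-T `KEYMAP-Record13-v1.6.md`: binder `θ : Stage13RParams`, `CoP ↦ CoPR`, SITE-RULE `X F N θ ↦ X F N θ.toStage13Params` for the edition-free θ-level objects) of this seat's v1.5 file of the same stem; the v1.5 file STANDS (settled helper); R-level pins over dag-n10-d's `Stage13RParams.rebindX` (`Node00/Record13CarriersCoPR` §0).  Prose pids ∕ FILE numbers below are those of the v1.5 `CoP` lineage where not updated; this image's v1.6 suppliers are node00-def-T FILE 25 p529474 `Record13CoPR` ∕ FILE 26T p529780 `Record13SepCoPR` and dag-n10-d g9 p530591 `Record13CarriersCoPR` + its `Record13CarriersSepCoPR`.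

# NODE 00 (YM-PLAN Track A) — THE [B8″H]-PINNED STAGE-13 RECORD AT PRINT'S BACKGROUND (KEY-RULE-21 Co ∕ SepCo image of
# `Node00/Record13CarriersB8SubBH`): the pin faces of `Stage13RParams.pinB8SubBH` read at the Co Stage-5 view `toStage5₁₃CoPR`, the v1.6 provisos
# `Provisos₁₃SepCoPR` transported along the pin, the UP-SIDE datums `datumOfRecord₁₃CoPR ∕ datumOfRecord₁₃SepCoPR` (`rfl`), the `b8` leaf over the [B8″H]-pinned
# Co view BY `Iff.rfl`, and the ONE-pin S-bound record AT THE v1.6 KEY `IsRecordOfRecord₁₃CSepCoPRSB8subBH` (companion in `IsRecordOfRecord₁₃CSepCoPR`; faces; the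
# reading; slot form; rebind) — director-ym LINE №152 RULING (β) ∕ R257 co-twin row C1 (dag-lead ORPHAN-STOREYS, 2026-08-27)

NODE 00 RECORD MODULE (seat `pub-ymgap-dag-n05-d` g6, 2026-08-27).  APPEND-ONLY: a NEW importing module; NOTHING in `Record13CarriersB8SubBH` (dag-n05-c g6,
p511153), `Record13CarriersSepCoPR` ∕ `Record13CarriersCoPR` (dag-n10-d g9, v1.6; p530591 for the latter), `Record13SepCoPR` (node00-def-T FILE 26T, p529780), `Record13CoPR` (FILE 25,
p529474) or below them is edited; everything is CONSUMED BY NAME (the pin faces are ONE-LINE instances of dag-n10-d's generic `rebindX` faces).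

WHY.  RECORD 13 was re-based ONCE at print's background `U_k(V)` (director-ym №152 (β)): the Stage-5 view of record is now `Stage13RParams.toStage5₁₃CoPR`
(residual `residualOfStage13CoPR`: `V := VOfRecord₁₃CoPR`, `S218 := S218OfRecord₁₃CoPR`), the provisos of record are v1.6 `Provisos₁₃SepCoPR` (row `bg` AT `UbgOfRecord₁₃CoPR`),
the datum is `datumOfRecord₁₃SepCoPR θ h := datumOfRecord₁₃CoPR θ h.toCore` and the record family is `IsRecordOfRecord₁₃CSepCoPR` (projection `.toCoPR` onto FILE 21's
`IsRecordOfRecord₁₃CCoPR`).  The N05 ∃-currency record on the REPAIRED carrier — dag-n05-c's `IsRecordOfRecord₁₃CSepSB8subBH` (U_old key `Provisos₁₃Sep ∕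
datumOfRecord₁₃Sep ∕ toStage5₁₃`) — therefore needs its image at the corrected key before the N05 knit faces (`Thm/BalabanUVNodesN05SubBHKnitT8E`, p515416) can be
booked at the record of record.  THIS FILE is that image under KEY-RULE-21 (node00-def-T, 2026-08-27): (R2) `toStage5₁₃ ↦ toStage5₁₃CoPR`, (R5) `…Sep… ↦ …SepCo…`,
(R1) `₁₃C ↦ ₁₃CCo` for the core record; every statement SHAPE is the U_old one token for token (HYP-AUDIT: no binder dropped, weakened or added).  The θ-level [B8″H]
pin (`Stage13Params.pinB8SubBH`, its `rfl` faces; dag-n05-c) is background-FREE and is CITED from `Record13CarriersB8SubBH`, never re-declared — its R-LIFT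
`Stage13RParams.pinB8SubBH` (§0, ONE R-level re-binding over dag-n10-d's `Stage13RParams.rebindX`, faces as instances of the generic ones) is the one new definition here;
the [B8″H] slot `B8LeafOfRecordSubBH θ λ` (`Node00/CarriersB8SubBH`) is background-free too — the N05 content of the record does not move, only its address.

WHAT IS PROVED (kernel bookkeeping, 0 sorry, no new mathematics).
§0 the R-lift `Stage13RParams.pinB8SubBH` + faces (`_eq_rebindX ∕ _toStage13Params ∕ _Zr ∕ _res_X ∕ _toStage3Params ∕ _L_γ_ε₂₉ ∕ _admissible_iff`, `Provisos₁₃CoPR.pinB8SubBH`).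
§1 `Stage13RParams.toStage5₁₃CoPR_pinB8SubBH` (the Co view of the pinned parameters IS the re-bound Co view — the [B8″H] instance of dag-n10-d's generic
`toStage5₁₃CoPR_rebindX`), `Stage13RParams.Provisos₁₃SepCoPR.pinB8SubBH` (the twelve v1.6 rows read no carrier: field by field, the [B8″H] instance of
`Provisos₁₃SepCoPR.rebindX`), UP-SIDE datums `datumOfRecord₁₃CoPR_pinB8SubBH ∕ datumOfRecord₁₃SepCoPR_pinB8SubBH` (`rfl`), the leaves
`upOfRecord₅CS_toStage5₁₃CoPR_pinB8SubBH_b8_iff` (`b8 ↔ B8LeafOfRecordSubBH`, `Iff.rfl`), `upOfRecord₅C_toStage5₁₃CoPR_pinB8SubBH_b8_iff` (typed, `Iff.rfl`),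
`upOfRecord₅CS_toStage5₁₃CoPR_pinB8SubBH_offB8` (`rfl` ×5), and the C-bound presentations `isRecordOfRecord₁₃CCoPR_pinB8SubBH_of_eq` ∕ `isRecordOfRecord₁₃CSepCoPR_pinB8SubBH_of_eq`.
§2 **`IsRecordOfRecord₁₃CSepCoPRSB8subBH`** (the v1.6-keyed ONE-pin S-bound record on the repaired carrier), `exists_world_…` (world displayed), **`companion_of_…`** (same
D ∕ C ∕ γ ∕ L in `IsRecordOfRecord₁₃CSepCoPR`, witness `θ.pinB8SubBH λ`; typed ⇒ surviving), `leaf_b8_iff_of_…`, `leaf_b8_iff_subB_and_t8H_of_…` (THE READING at the record),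
`exists_isRecordOfRecord₁₃CSepCoPR_of_…`, `exists_isRecordOfRecord₁₃CCoPR_of_…` (projection to FILE 21's core family), `b4_b5_b6_b7_of_…` (def-T's transfer
`atWorld_of_isRecordOfRecord₁₃CSepCoPR` at the companion), `b8_b11_b10_main_iff_of_…`, `b8_main_of_…_of_slot`, `b8_main_of_…_of_subB_fields`,
`…_rebind_of_isRecordOfRecord₁₃CSepCoPR` (the ∃-currency entry point: the [B8] layer is CHOSEN there), `exists_provisos_of_…`.
NOT IMAGED (located, R257 row C1∕C2): the un-repaired lineage `Record13CarriersB8SubB` ∕ `Thm/BalabanUVNodesN05AtRecord13SubB{,T8,T8B9}` — its slot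
`B8LeafOfRecordSubB θ λ` is certified EMPTY for every `λ` (`B8LeafModelZd3SourceReality.not_b8LeafOfRecordSubB`, p501857), a background-free fact, so its Co image
would be vacuous verbatim; the present file is the image of its declared repaired successor.
HONEST FRAMING: definitions + kernel bookkeeping; NO estimate; nothing of Bałaban's asserted; whether the repaired slot CLOSES is the knits' ∕ providers' business;
N05 NOT discharged; counts unmoved (typed 28∕28 · discharged 5∕27); one finite T⁴ programme at fixed ε — NOT continuum ∕ ℝ⁴ ∕ infinite volume ∕ OS ∕ mass gap ∕
Clay.  No `sorry`, no `axiom`, no `opaque`, no `instance`, no `notation`.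
[Balaban1985RegularSpaces] = Commun. Math. Phys. **99** (1985) 75–102; [Balaban1989LargeFieldII] = Commun. Math. Phys. **122** (1989) 355–392; [Balaban1988Convergent] = Commun.
Math. Phys. **119** (1988) 243–285. -/

noncomputable section

namespace Literature.MathematicalPhysics.QuantumFieldTheory.Balaban1983to89.Node00

open T4Continuum AveragingRT T4FiniteEpsInhabited FlowStep FlowStepRuns DagBinding T4DatumAssembly
open B8LeafKnitRS (B8LeafRS)
open B8IdxB8LawsB (IdxB8SubB famB8OfRecordSubB)
open scoped Matrix.Norms.L2Operator

/-! ## §0 (R). THE R-LIFT OF THE [B8″H] PIN: `Stage13RParams.pinB8SubBH` — ONE R-level re-binding (dag-n10-d's `Stage13RParams.rebindX`) over dag-n05-c's θ-level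
carrier substitution `withB8OfRecordSubBH`; its Stage-13 part IS dag-n05-c's θ-level pin `Stage13Params.pinB8SubBH` (`rfl`) -/

section PinB8SubBH13R

variable (F : T4Family) (N : ℕ) [NeZero N]

/-- **The [B8″H] pin of the v1.6 Stage-13 parameters** (run-indexed residual 𝐓-weight slot `Zr` untouched): the carrier bundle re-bound, run by run, to the [B8] group of
record READ AT THE REPAIRED MEMBERS (`withB8OfRecordSubBH`, dag-n05-c). [cite: Balaban1985RegularSpaces, Thm 2 p.83, Thm 8 (1.146) p.101 (objects of record, Stage 3′(X.B8″H))] -/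
def Stage13RParams.pinB8SubBH (θ : Stage13RParams F N) (lam : ResidB8 θ.toStage3Params) : Stage13RParams F N :=
  θ.rebindX F N fun P => (θ.res.X P).withB8OfRecordSubBH θ.toStage3Params lam

/-- Unfolding (`rfl`): the pin IS one generic R-level `rebindX`. [cite: Balaban1988Convergent, p.244 (bookkeeping)] -/
theorem Stage13RParams.pinB8SubBH_eq_rebindX (θ : Stage13RParams F N) (lam : ResidB8 θ.toStage3Params) :
    θ.pinB8SubBH F N lam = θ.rebindX F N (fun P => (θ.res.X P).withB8OfRecordSubBH θ.toStage3Params lam) := rfl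

/-- Its Stage-13 part IS dag-n05-c's θ-level [B8″H] pin (`rfl`). [cite: Balaban1988Convergent, p.244 (bookkeeping)] -/
theorem Stage13RParams.pinB8SubBH_toStage13Params (θ : Stage13RParams F N) (lam : ResidB8 θ.toStage3Params) :
    (θ.pinB8SubBH F N lam).toStage13Params = θ.toStage13Params.pinB8SubBH F N lam := rfl

/-- The run-indexed residual 𝐓-weight slot is untouched (`rfl`). [cite: Balaban1988Convergent, (3.16)–(3.20) pp.268–269 (bookkeeping)] -/
theorem Stage13RParams.pinB8SubBH_Zr (θ : Stage13RParams F N) (lam : ResidB8 θ.toStage3Params) : (θ.pinB8SubBH F N lam).Zr = θ.Zr :=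
  (Stage13RParams.rebindX_toStage13Params F N θ _).2

/-- The pinned carrier family (`rfl`). [cite: Balaban1985RegularSpaces, Thm 2 p.83 (bookkeeping)] -/
theorem Stage13RParams.pinB8SubBH_res_X (θ : Stage13RParams F N) (lam : ResidB8 θ.toStage3Params) (P : B12.RunParams) :
    (θ.pinB8SubBH F N lam).res.X P = (θ.res.X P).withB8OfRecordSubBH θ.toStage3Params lam := rfl

/-- The Stage-3 dictionary is untouched (`rfl`, dag-n05-c's θ-level face read through `toStage13Params`). [cite: Balaban1984PropagatorsII, pp.223–250 (bookkeeping)] -/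
theorem Stage13RParams.pinB8SubBH_toStage3Params (θ : Stage13RParams F N) (lam : ResidB8 θ.toStage3Params) :
    (θ.pinB8SubBH F N lam).toStage3Params = θ.toStage3Params :=
  Stage13Params.pinB8SubBH_toStage3Params F N θ.toStage13Params lam

/-- Block size, interval letter and the (2.9) letter are untouched (`rfl` ×3). [cite: Balaban1987RG1, (0.1) p.250, (2.9) p.266 (bookkeeping)] -/
theorem Stage13RParams.pinB8SubBH_L_γ_ε₂₉ (θ : Stage13RParams F N) (lam : ResidB8 θ.toStage3Params) :
    (θ.pinB8SubBH F N lam).L = θ.L ∧ (θ.pinB8SubBH F N lam).γ = θ.γ ∧ (θ.pinB8SubBH F N lam).ε₂₉ = θ.ε₂₉ :=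
  Stage13Params.pinB8SubBH_L_γ_ε₂₉ F N θ.toStage13Params lam

/-- Admissibility is read at `θ` (dag-n05-c's θ-level face through `toStage13Params`). [cite: Balaban1987RG1, (1.20)–(1.21) p.264 (bookkeeping)] -/
theorem Stage13RParams.pinB8SubBH_admissible_iff (θ : Stage13RParams F N) (lam : ResidB8 θ.toStage3Params) :
    (θ.pinB8SubBH F N lam).Admissible F N ↔ θ.Admissible F N :=
  Stage13Params.pinB8SubBH_admissible_iff F N θ.toStage13Params lam

variable {F N} in
/-- The v1.6 bg-free core provisos transport along the [B8″H] pin (instance of dag-n10-d's `Provisos₁₃CoPR.rebindX`). [cite: Balaban1988Convergent, (2.18) p.257, (3.2)–(3.9) pp.265–266 (bookkeeping)] -/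
theorem Stage13RParams.Provisos₁₃CoPR.pinB8SubBH {θ : Stage13RParams F N} (h : θ.Provisos₁₃CoPR F N) (lam : ResidB8 θ.toStage3Params) :
    (θ.pinB8SubBH F N lam).Provisos₁₃CoPR F N :=
  h.rebindX _

end PinB8SubBH13R

/-! ## §1. The [B8″H] pin read at the Co Stage-5 view; the v1.6 provisos along the pin; UP-SIDE Co ∕ SepCo datums; the `b8` leaf over the pinned Co view -/

section PinB8SubBH13CoPR

variable (F : T4Family) (N : ℕ) [NeZero N]

/-- The Co Stage-13 view of [B8″H]-pinned parameters IS the re-bound Co Stage-13 view (`rfl`: the Co residual reads `S218OfRecord₁₃CoPR ∕ VOfRecord₁₃CoPR ∕ betaOfRecord₁₃ ∕ EOfRecord₁₃ ∕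
gOfRecord₁₃`, never `res.X`; the [B8″H] instance of dag-n10-d's generic `Stage13RParams.toStage5₁₃CoPR_rebindX`). [cite: Balaban1988Convergent, p.244 (bookkeeping)] -/
theorem Stage13RParams.toStage5₁₃CoPR_pinB8SubBH (θ : Stage13RParams F N) (lam : ResidB8 θ.toStage3Params) :
    (θ.pinB8SubBH F N lam).toStage5₁₃CoPR F N = (θ.toStage5₁₃CoPR F N).rebindX F N (fun P => (θ.res.X P).withB8OfRecordSubBH θ.toStage3Params lam) :=
  Stage13RParams.toStage5₁₃CoPR_rebindX F N θ _

variable {F N} in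
/-- The v1.6 separated-range provisos AT PRINT'S BACKGROUND read no carrier: they transport along the [B8″H] pin (twelve rows, field by field; row `bg` reads `γ`,
`gOfRecord₁₃`, `PartCompat₁₃`, `settingOfRecord₁₃`, `Rz`, `τ9`, `suppOfRecord₁₃SepCo`, `UbgOfRecord₁₃CoPR` — never `res.X`; the [B8″H] instance of dag-n10-d's
`Provisos₁₃SepCoPR.rebindX`). [cite: Balaban1988Convergent, (2.18) p.257, (2.23)–(2.42) pp.259–262, (3.2)–(3.9) pp.265–266; Balaban1985RegularSpaces, (1.3)–(1.9) pp.76–77 (bookkeeping)] -/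
theorem Stage13RParams.Provisos₁₃SepCoPR.pinB8SubBH {θ : Stage13RParams F N} (h : θ.Provisos₁₃SepCoPR F N) (lam : ResidB8 θ.toStage3Params) :
    (θ.pinB8SubBH F N lam).Provisos₁₃SepCoPR F N :=
  h.rebindX _

/-- UP-SIDE (Co core): the core-keyed datum AT PRINT'S BACKGROUND is unchanged by the [B8″H] pin (`rfl`; the [B8″H] instance of dag-n10-d's `datumOfRecord₁₃CoPR_rebindX`).
[cite: Balaban1989LargeFieldII, Thm 1 + (0.1) pp.355–356 (bookkeeping)] -/
theorem datumOfRecord₁₃CoPR_pinB8SubBH (θ : Stage13RParams F N) (h : θ.Provisos₁₃CoPR F N) (lam : ResidB8 θ.toStage3Params) :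
    datumOfRecord₁₃CoPR F N (θ.pinB8SubBH F N lam) (h.pinB8SubBH lam) = datumOfRecord₁₃CoPR F N θ h :=
  datumOfRecord₁₃CoPR_rebindX F N θ h _ (h.pinB8SubBH lam)

/-- UP-SIDE (v1.6 separated range, Co): the datum of record is unchanged by the [B8″H] pin (`rfl`; instance of `datumOfRecord₁₃SepCoPR_rebindX`).
[cite: Balaban1989LargeFieldII, Thm 1 + (0.1) pp.355–356 (bookkeeping)] -/
theorem datumOfRecord₁₃SepCoPR_pinB8SubBH (θ : Stage13RParams F N) (h : θ.Provisos₁₃SepCoPR F N) (lam : ResidB8 θ.toStage3Params) :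
    datumOfRecord₁₃SepCoPR F N (θ.pinB8SubBH F N lam) (h.pinB8SubBH lam) = datumOfRecord₁₃SepCoPR F N θ h :=
  datumOfRecord₁₃SepCoPR_rebindX F N θ h _ (h.pinB8SubBH lam)

/-- **THE `b8` LEAF OF THE S-BINDING OVER THE [B8″H]-PINNED Co STAGE-13 VIEW IS `B8LeafOfRecordSubBH`** (`Iff.rfl`: the S-binding's `b8` reads `res.X`, which the Co view
does not touch). [cite: Balaban1985RegularSpaces, Lemma 1 – Thm 8 pp.79–101, Thm 8 (1.146) p.101 (the leaf at the repaired objects of record)] -/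
theorem upOfRecord₅CS_toStage5₁₃CoPR_pinB8SubBH_b8_iff (θ : Stage13RParams F N) (lam : ResidB8 θ.toStage3Params) (P : B12.RunParams) :
    (upOfRecord₅CS F N ((θ.pinB8SubBH F N lam).toStage5₁₃CoPR F N) P).b8 ↔ B8LeafOfRecordSubBH θ.toStage3Params lam :=
  Iff.rfl

/-- … and the C-binding's `b8` over it is the leaf AS TYPED at the repaired group (`Iff.rfl`). [cite: Balaban1985RegularSpaces, Lemma 1 – Thm 8 pp.79–101 (bookkeeping)] -/
theorem upOfRecord₅C_toStage5₁₃CoPR_pinB8SubBH_b8_iff (θ : Stage13RParams F N) (lam : ResidB8 θ.toStage3Params) (P : B12.RunParams) :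
    (upOfRecord₅C F N ((θ.pinB8SubBH F N lam).toStage5₁₃CoPR F N) P).b8 ↔
      B8LeafR θ.D (θ.L : ℝ) lam.C₂ lam.B₁' lam.inp.B₀' lam.B₁ lam.B₂ lam.c₁ lam.inp lam.B₀β (B8Lemma1NonAbelian.blockPairNA θ.D θ.L θ.𝔸)
        (fun j : IdxB8SubB θ.toStage3Params => famB8OfRecordSubBH θ.toStage3Params lam.β lam.len j) lam.lan lam.cub (fun j => lam.toAxial j.1) :=
  Iff.rfl

/-- The other leaves of the S-binding over the [B8″H]-pinned Co Stage-13 view are the C-binding's over the UNPINNED Co Stage-13 view (`rfl` ×5: the pin moves only the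
[B8] group, the S-binding re-binds only `b8`). [cite: Balaban1989LargeFieldII, Thm 1 p.355 (bookkeeping)] -/
theorem upOfRecord₅CS_toStage5₁₃CoPR_pinB8SubBH_offB8 (θ : Stage13RParams F N) (lam : ResidB8 θ.toStage3Params) (P : B12.RunParams) :
    (upOfRecord₅CS F N ((θ.pinB8SubBH F N lam).toStage5₁₃CoPR F N) P).b9 = (upOfRecord₅C F N (θ.toStage5₁₃CoPR F N) P).b9 ∧
    (upOfRecord₅CS F N ((θ.pinB8SubBH F N lam).toStage5₁₃CoPR F N) P).b10 = (upOfRecord₅C F N (θ.toStage5₁₃CoPR F N) P).b10 ∧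
    (upOfRecord₅CS F N ((θ.pinB8SubBH F N lam).toStage5₁₃CoPR F N) P).b11 = (upOfRecord₅C F N (θ.toStage5₁₃CoPR F N) P).b11 ∧
    (upOfRecord₅CS F N ((θ.pinB8SubBH F N lam).toStage5₁₃CoPR F N) P).b12 = (upOfRecord₅C F N (θ.toStage5₁₃CoPR F N) P).b12 ∧
    (upOfRecord₅CS F N ((θ.pinB8SubBH F N lam).toStage5₁₃CoPR F N) P).rBasicStep = (upOfRecord₅C F N (θ.toStage5₁₃CoPR F N) P).rBasicStep :=
  ⟨rfl, rfl, rfl, rfl, rfl⟩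

/-- **The C-bound presentation at the Co CORE key** (the [B8″H] instance of dag-n10-d's `isRecordOfRecord₁₃CCoPR_rebindX_of_eq`): a world with def-T's pointed clauses whose
upstream blocks are the C-binding over the [B8″H]-PINNED Co Stage-13 view IS a Co core record at `datumOfRecord₁₃CoPR θ h`. [cite: Balaban1989LargeFieldII, Thm 1 + (0.1) pp.355–356 (bookkeeping)] -/
theorem isRecordOfRecord₁₃CCoPR_pinB8SubBH_of_eq (θ : Stage13RParams F N) (h : θ.Provisos₁₃CoPR F N) (hθ : θ.Admissible F N) (lam : ResidB8 θ.toStage3Params)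
    (w : WorldP) (hC : w.C = (datumOfRecord₁₃CoPR F N θ h).C) (hγ : 0 < w.γ ∧ w.γ ≤ θ.γ) (hL : w.L = (θ.L : ℝ))
    (hup : ∀ P, w.up P = upOfRecord₅C F N ((θ.pinB8SubBH F N lam).toStage5₁₃CoPR F N) P) :
    IsRecordOfRecord₁₃CCoPR F N (datumOfRecord₁₃CoPR F N θ h) w :=
  isRecordOfRecord₁₃CCoPR_rebindX_of_eq F N θ h hθ _ w hC hγ hL hup

/-- **The C-bound presentation at the v1.6 key** (the [B8″H] instance of dag-n10-d's `isRecordOfRecord₁₃CSepCoPR_rebindX_of_eq`): a world with def-T's pointed clauses whose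
upstream blocks are the C-binding over the [B8″H]-PINNED Co Stage-13 view IS a v1.6 ₁₃C record at `datumOfRecord₁₃SepCoPR θ h`. [cite: Balaban1989LargeFieldII, Thm 1 + (0.1) pp.355–356 (bookkeeping)] -/
theorem isRecordOfRecord₁₃CSepCoPR_pinB8SubBH_of_eq (θ : Stage13RParams F N) (h : θ.Provisos₁₃SepCoPR F N) (hθ : θ.Admissible F N) (lam : ResidB8 θ.toStage3Params)
    (w : WorldP) (hC : w.C = (datumOfRecord₁₃SepCoPR F N θ h).C) (hγ : 0 < w.γ ∧ w.γ ≤ θ.γ) (hL : w.L = (θ.L : ℝ))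
    (hup : ∀ P, w.up P = upOfRecord₅C F N ((θ.pinB8SubBH F N lam).toStage5₁₃CoPR F N) P) :
    IsRecordOfRecord₁₃CSepCoPR F N (datumOfRecord₁₃SepCoPR F N θ h) w :=
  isRecordOfRecord₁₃CSepCoPR_rebindX_of_eq F N θ h hθ _ w hC hγ hL hup

end PinB8SubBH13CoPR

/-! ## §2. The ONE-pin S-bound Stage-13 record with [B8″H] AT THE v1.6 KEY (SepCo); companion in `₁₃CSepCo`; faces; the reading; rebind -/

section Record13SepCoPRB8subBH

variable (F : T4Family) (N : ℕ) [NeZero N]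

/-- **«(D, w) is the record, Stage 13 (separated range), [B8] group pinned over the four-law sub-index ON THE REPAIRED CARRIER, `b8` surviving»**: def-T's
`IsRecordOfRecord₁₃CSepCoPR` VERBATIM except that the world is bound by the S-binding over the [B8″H]-PINNED Stage-13 view, for SOME residual [B8] layer `lam`.
[cite: Balaban1985RegularSpaces, Lemma 1 – Thm 8 pp.79–101, Thm 8 (1.146) p.101, (1.12) p.78; Balaban1989LargeFieldII, Thm 1 + (0.1) pp.355–356 (objects of record)] -/
def IsRecordOfRecord₁₃CSepCoPRSB8subBH (D : FiniteEpsData F (SU N)) (w : WorldP) : Prop :=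
  ∃ (θ : Stage13RParams F N) (h : θ.Provisos₁₃SepCoPR F N) (lam : ResidB8 θ.toStage3Params),
    θ.Admissible F N ∧ D = datumOfRecord₁₃SepCoPR F N θ h ∧ w.C = D.C ∧ (0 < w.γ ∧ w.γ ≤ θ.γ) ∧ w.L = (θ.L : ℝ) ∧
      ∀ P : B12.RunParams, w.up P = upOfRecord₅CS F N ((θ.pinB8SubBH F N lam).toStage5₁₃CoPR F N) P

/-- Inhabitation is Stage 13's exactly (the residual [B8] type is inhabited, `nonempty_residB8`): every admissible separated-range parameter presents a record of this module
at its own datum, ANY residual layer `lam`, any window. [cite: Balaban1989LargeFieldII, Thm 1 + (0.1) pp.355–356 (bookkeeping)] -/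
theorem exists_world_isRecordOfRecord₁₃CSepCoPRSB8subBH (θ : Stage13RParams F N) (h : θ.Provisos₁₃SepCoPR F N) (hθ : θ.Admissible F N) (lam : ResidB8 θ.toStage3Params)
    {γw : ℝ} (hγw : 0 < γw ∧ γw ≤ θ.γ) :
    ∃ w : WorldP, IsRecordOfRecord₁₃CSepCoPRSB8subBH F N (datumOfRecord₁₃SepCoPR F N θ h) w ∧ w.γ = γw ∧
      ∀ P : B12.RunParams, w.up P = upOfRecord₅CS F N ((θ.pinB8SubBH F N lam).toStage5₁₃CoPR F N) P := by
  obtain ⟨w₀, -, -⟩ := exists_world_isRecordOfRecord₁₃CSepCoPR F N θ h hθ hγw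
  exact ⟨{ w₀ with
      C := (datumOfRecord₁₃SepCoPR F N θ h).C, γ := γw, L := (θ.L : ℝ), one_lt_L := by exact_mod_cast θ.hL.2,
      up := fun P => upOfRecord₅CS F N ((θ.pinB8SubBH F N lam).toStage5₁₃CoPR F N) P },
    ⟨θ, h, lam, hθ, rfl, rfl, hγw, rfl, fun _ => rfl⟩, rfl, fun _ => rfl⟩

variable {F N}
variable {D : FiniteEpsData F (SU N)} {w : WorldP}

/-- **THE SAME-DATUM COMPANION IN `IsRecordOfRecord₁₃CSepCoPR`** (witness `θ.pinB8SubBH lam` under the C-binding): same `D`, `C`, window, `L`; leaves agree off `b8`; companion's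
`b8` (typed, over the repaired sub-family) ⇒ record's `b8` (surviving) under the carrier law (1.36) ⊂ (1.62) — never conversely.
[cite: Balaban1985RegularSpaces, Thm 8 p.101 (surviving vs typed); Balaban1989LargeFieldII, Thm 1 + (0.1) pp.355–356 (bookkeeping)] -/
theorem companion_of_isRecordOfRecord₁₃CSepCoPRSB8subBH (h : IsRecordOfRecord₁₃CSepCoPRSB8subBH F N D w) :
    ∃ w' : WorldP, IsRecordOfRecord₁₃CSepCoPR F N D w' ∧ w'.C = w.C ∧ w'.γ = w.γ ∧ w'.L = w.L ∧
      (∀ P : B12.RunParams, leavesP w P = { leavesP w' P with b8 := (leavesP w P).b8 }) ∧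
      ∀ P : B12.RunParams, (leavesP w' P).b8 → (leavesP w P).b8 := by
  obtain ⟨θ, hP, lam, hθ, hD, hC, hγ, hL, hup⟩ := h
  have hup' : ∀ P, w.up P = (upOfRecord₅C F N ((θ.pinB8SubBH F N lam).toStage5₁₃CoPR F N) P).withB8 (leavesP w P).b8 := fun P => by
    show w.up P = (upOfRecord₅C F N _ P).withB8 (w.up P).b8
    rw [hup P]
    rfl
  refine ⟨{ w with up := fun P => upOfRecord₅C F N ((θ.pinB8SubBH F N lam).toStage5₁₃CoPR F N) P },
    ⟨θ.pinB8SubBH F N lam, hP.pinB8SubBH lam, (Stage13RParams.pinB8SubBH_admissible_iff F N _ _).2 hθ, ?_, hC, hγ, hL, fun P => rfl⟩, rfl, rfl, rfl,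
      leavesP_eq_of_up_withB8 hup', fun P h8 => ?_⟩
  · rw [datumOfRecord₁₃SepCoPR_pinB8SubBH F N θ hP lam]; exact hD
  · have h8' := (upOfRecord₅C_toStage5₁₃CoPR_pinB8SubBH_b8_iff F N θ lam P).1 h8
    show (w.up P).b8
    rw [hup P]
    exact (upOfRecord₅CS_toStage5₁₃CoPR_pinB8SubBH_b8_iff F N θ lam P).2 (b8LeafOfRecordSubBH_of_b8LeafR lam h8')

/-- The `b8` leaf at a record of this module, for ONE parameter package: it IS the repaired slot. [cite: Balaban1985RegularSpaces, Lemma 1 – Thm 8 pp.79–101 (bookkeeping)] -/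
theorem leaf_b8_iff_of_isRecordOfRecord₁₃CSepCoPRSB8subBH (h : IsRecordOfRecord₁₃CSepCoPRSB8subBH F N D w) :
    ∃ (θ : Stage13RParams F N) (lam : ResidB8 θ.toStage3Params), θ.Admissible F N ∧ w.L = (θ.L : ℝ) ∧
      ∀ P : B12.RunParams, (leavesP w P).b8 ↔ B8LeafOfRecordSubBH θ.toStage3Params lam := by
  obtain ⟨θ, -, lam, hθ, -, -, -, hL, hup⟩ := h
  refine ⟨θ, lam, hθ, hL, fun P => ?_⟩
  show (w.up P).b8 ↔ _
  rw [hup P]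
  exact upOfRecord₅CS_toStage5₁₃CoPR_pinB8SubBH_b8_iff F N θ lam P

/-- **THE READING AT THE RECORD**: at a record of this module the `b8` leaf is, for its presenting package, «the old pin's EIGHT non-Theorem-8 conjuncts (over `famB8OfRecordSubB`,
letter for letter the knits' conclusions) ∧ Theorem 8 surviving at γ = 1 AT THE REPAIRED MEMBERS» (`CarriersB8SubBH.b8LeafOfRecordSubBH_iff_subB_and_t8H`).
[cite: Balaban1985RegularSpaces, Lemma 1 p.79, Thm 2 p.83, Prop. 3 p.87, Thm 4 p.88, Prop. 5 p.94, Prop. 6 p.99, Prop. 7 p.100, Thm 8 (1.146) p.101] -/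
theorem leaf_b8_iff_subB_and_t8H_of_isRecordOfRecord₁₃CSepCoPRSB8subBH (h : IsRecordOfRecord₁₃CSepCoPRSB8subBH F N D w) :
    ∃ (θ : Stage13RParams F N) (lam : ResidB8 θ.toStage3Params), θ.Admissible F N ∧ w.L = (θ.L : ℝ) ∧
      ∀ P : B12.RunParams, (leavesP w P).b8 ↔
        (B8.Lemma1Printed θ.D (B8Lemma1NonAbelian.blockPairNA θ.D θ.L θ.𝔸) ∧
          B8.Thm2Printed (fun j : IdxB8SubB θ.toStage3Params => (famB8OfRecordSubB θ.toStage3Params lam.β lam.len j).toGFData) ∧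
          B8.Prop3Printed θ.D (θ.L : ℝ) lam.C₂ lam.inp lam.B₀β
            (fun j : IdxB8SubB θ.toStage3Params => (famB8OfRecordSubB θ.toStage3Params lam.β lam.len j).toGFData2) ∧
          B8.Thm4Printed lam.B₁' (fun j : IdxB8SubB θ.toStage3Params => (famB8OfRecordSubB θ.toStage3Params lam.β lam.len j).toGFData) ∧
          B8.Prop5Exists lam.inp.B₀' lam.B₁ lam.lan ∧ B8.Prop5Unique lam.lan ∧ B8.Prop6Printed θ.D (θ.L : ℝ) lam.B₁ lam.c₁ lam.cub ∧
          B8SectGH.Prop7PrintedR (fun j : IdxB8SubB θ.toStage3Params => famB8OfRecordSubB θ.toStage3Params lam.β lam.len j) (fun j => lam.toAxial j.1)) ∧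
        B8Thm8Surviving.Thm8SurvivingAt 1 lam.B₁ lam.B₂ (fun j : IdxB8SubB θ.toStage3Params => famB8OfRecordSubBH θ.toStage3Params lam.β lam.len j) := by
  obtain ⟨θ, lam, hθ, hL, hiff⟩ := leaf_b8_iff_of_isRecordOfRecord₁₃CSepCoPRSB8subBH h
  exact ⟨θ, lam, hθ, hL, fun P => (hiff P).trans (b8LeafOfRecordSubBH_iff_subB_and_t8H lam)⟩

/-- A record of this module IS (through its companion) a separated-range Stage-13 record of the same datum at a world with the same `C ∕ γ ∕ L`.
[cite: Balaban1989LargeFieldII, Thm 1 + (0.1) pp.355–356 (bookkeeping)] -/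
theorem exists_isRecordOfRecord₁₃CSepCoPR_of_isRecordOfRecord₁₃CSepCoPRSB8subBH (h : IsRecordOfRecord₁₃CSepCoPRSB8subBH F N D w) :
    ∃ w' : WorldP, IsRecordOfRecord₁₃CSepCoPR F N D w' ∧ w'.C = w.C ∧ w'.γ = w.γ ∧ w'.L = w.L := by
  obtain ⟨w', hw', hC, hγ, hL, -, -⟩ := companion_of_isRecordOfRecord₁₃CSepCoPRSB8subBH h
  exact ⟨w', hw', hC, hγ, hL⟩

/-- … hence (along `IsRecordOfRecord₁₃CSepCoPR.toCoPR`) a Co CORE Stage-13 record of the same datum at a world with the same `C ∕ γ ∕ L` — the projection by which storeys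
keyed ONCE on FILE 21's core family serve this record. [cite: Balaban1989LargeFieldII, Thm 1 + (0.1) pp.355–356 (bookkeeping)] -/
theorem exists_isRecordOfRecord₁₃CCoPR_of_isRecordOfRecord₁₃CSepCoPRSB8subBH (h : IsRecordOfRecord₁₃CSepCoPRSB8subBH F N D w) :
    ∃ w' : WorldP, IsRecordOfRecord₁₃CCoPR F N D w' ∧ w'.C = w.C ∧ w'.γ = w.γ ∧ w'.L = w.L := by
  obtain ⟨w', hw', hC, hγ, hL⟩ := exists_isRecordOfRecord₁₃CSepCoPR_of_isRecordOfRecord₁₃CSepCoPRSB8subBH h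
  exact ⟨w', hw'.toCoPR, hC, hγ, hL⟩

/-- The in-edges `b4 b5 b6 b7` are THEOREMS at a record of this module (via the companion and def-T's v1.6 transfer `atWorld_of_isRecordOfRecord₁₃CSepCoPR`).
[cite: Balaban1983RegularityDecay, Thm p.573; Balaban1984PropagatorsI, Props. 1.1–1.2 pp.33–36; Balaban1984PropagatorsII, pp.223–250; Balaban1985Averaging, Props. 1–10 pp.26–50 (bookkeeping)] -/
theorem b4_b5_b6_b7_of_isRecordOfRecord₁₃CSepCoPRSB8subBH (h : IsRecordOfRecord₁₃CSepCoPRSB8subBH F N D w) (P : B12.RunParams) :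
    (leavesP w P).b4 ∧ (leavesP w P).b5 ∧ (leavesP w P).b6 ∧ (leavesP w P).b7 := by
  obtain ⟨w', hw', -, -, -, hleaves, -⟩ := companion_of_isRecordOfRecord₁₃CSepCoPRSB8subBH h
  have h' : (leavesP w' P).b4 ∧ (leavesP w' P).b5 ∧ (leavesP w' P).b6 ∧ (leavesP w' P).b7 :=
    atWorld_of_isRecordOfRecord₁₃CSepCoPR (X := fun ℓ => ℓ.b4 ∧ ℓ.b5 ∧ ℓ.b6 ∧ ℓ.b7)
      (fun _ _ h5 P =>
        have h4 := b4_main_of_isRecordOfRecord₅C h5 P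
        have hb5 := b5_main_of_isRecordOfRecord₅C h5 P h4
        ⟨h4, hb5, N03_at_record₅C h5 P h4 hb5, b7_main_of_isRecordOfRecord₅C h5 P hb5⟩) hw' P
  rw [hleaves P]
  exact h'

/-- **N05 ∕ N07 ∕ N08 AT A RECORD OF THIS MODULE** (in-edges b4–b7 are theorems). [cite: Balaban1985RegularSpaces, Thm 2 p.83, Thm 8 p.101; Balaban1985Variational, Thm 1 p.279; Balaban1985UV3, Thm 1 p.257 (bookkeeping)] -/
theorem b8_b11_b10_main_iff_of_isRecordOfRecord₁₃CSepCoPRSB8subBH (h : IsRecordOfRecord₁₃CSepCoPRSB8subBH F N D w) (P : B12.RunParams) :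
    (Dag.B8_main (leavesP w P) ↔ ((leavesP w P).b9 → (leavesP w P).b8)) ∧
    (Dag.B11_main (leavesP w P) ↔ ((leavesP w P).b8 → (leavesP w P).b9 → (leavesP w P).b11)) ∧
    (Dag.B10_main (leavesP w P) ↔ ((leavesP w P).b8 → (leavesP w P).b9 → (leavesP w P).b11 → (leavesP w P).b10)) := by
  obtain ⟨-, h5, h6, h7⟩ := b4_b5_b6_b7_of_isRecordOfRecord₁₃CSepCoPRSB8subBH h P
  exact ⟨⟨fun hN h9 => hN h5 h6 h7 h9, fun hN _ _ _ => hN⟩, ⟨fun hN h8 h9 => hN h5 h6 h7 h8 h9, fun hN _ _ _ => hN⟩,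
    ⟨fun hN h8 h9 h11 => hN h5 h6 h7 h8 h9 h11, fun hN _ _ _ => hN⟩⟩

/-- **N05 «SLOT» FORM at a record of this module**: a closer of the REPAIRED slot `B8LeafOfRecordSubBH` at every presenting package gives `Dag.B8_main` at every run.
[cite: Balaban1985RegularSpaces, Lemma 1 – Thm 8 pp.79–101, Thm 8 (1.146) p.101 (the node's shape, bookkeeping)] -/
theorem b8_main_of_isRecordOfRecord₁₃CSepCoPRSB8subBH_of_slot (h : IsRecordOfRecord₁₃CSepCoPRSB8subBH F N D w)
    (hB : ∀ (θ : Stage13RParams F N) (hP : θ.Provisos₁₃SepCoPR F N) (lam : ResidB8 θ.toStage3Params), θ.Admissible F N → D = datumOfRecord₁₃SepCoPR F N θ hP →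
      (∀ P, w.up P = upOfRecord₅CS F N ((θ.pinB8SubBH F N lam).toStage5₁₃CoPR F N) P) → B8LeafOfRecordSubBH θ.toStage3Params lam)
    (P : B12.RunParams) : Dag.B8_main (leavesP w P) := by
  obtain ⟨h8iff, -, -⟩ := b8_b11_b10_main_iff_of_isRecordOfRecord₁₃CSepCoPRSB8subBH h P
  obtain ⟨θ, hP, lam, hθ, hD, -, -, -, hup⟩ := h
  refine h8iff.2 fun _ => ?_
  show (w.up P).b8
  rw [hup P]
  exact (upOfRecord₅CS_toStage5₁₃CoPR_pinB8SubBH_b8_iff F N θ lam P).2 (hB θ hP lam hθ hD hup)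

/-- **N05 «SLOT» FORM, READ**: a supplier of the old pin's EIGHT conjuncts and of Theorem 8 surviving AT THE REPAIRED MEMBERS, at every presenting package, gives `Dag.B8_main` at
every run of a record of this module (the slot form through `b8LeafOfRecordSubBH_of_subB_fields`). [cite: Balaban1985RegularSpaces, Lemma 1 – Thm 8 pp.79–101, Thm 8 (1.146) p.101] -/
theorem b8_main_of_isRecordOfRecord₁₃CSepCoPRSB8subBH_of_subB_fields (h : IsRecordOfRecord₁₃CSepCoPRSB8subBH F N D w)
    (hB : ∀ (θ : Stage13RParams F N) (hP : θ.Provisos₁₃SepCoPR F N) (lam : ResidB8 θ.toStage3Params), θ.Admissible F N → D = datumOfRecord₁₃SepCoPR F N θ hP →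
      (∀ P, w.up P = upOfRecord₅CS F N ((θ.pinB8SubBH F N lam).toStage5₁₃CoPR F N) P) →
        (B8.Lemma1Printed θ.D (B8Lemma1NonAbelian.blockPairNA θ.D θ.L θ.𝔸) ∧
          B8.Thm2Printed (fun j : IdxB8SubB θ.toStage3Params => (famB8OfRecordSubB θ.toStage3Params lam.β lam.len j).toGFData) ∧
          B8.Prop3Printed θ.D (θ.L : ℝ) lam.C₂ lam.inp lam.B₀β
            (fun j : IdxB8SubB θ.toStage3Params => (famB8OfRecordSubB θ.toStage3Params lam.β lam.len j).toGFData2) ∧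
          B8.Thm4Printed lam.B₁' (fun j : IdxB8SubB θ.toStage3Params => (famB8OfRecordSubB θ.toStage3Params lam.β lam.len j).toGFData) ∧
          B8.Prop5Exists lam.inp.B₀' lam.B₁ lam.lan ∧ B8.Prop5Unique lam.lan ∧ B8.Prop6Printed θ.D (θ.L : ℝ) lam.B₁ lam.c₁ lam.cub ∧
          B8SectGH.Prop7PrintedR (fun j : IdxB8SubB θ.toStage3Params => famB8OfRecordSubB θ.toStage3Params lam.β lam.len j) (fun j => lam.toAxial j.1)) ∧
        B8Thm8Surviving.Thm8SurvivingAt 1 lam.B₁ lam.B₂ (fun j : IdxB8SubB θ.toStage3Params => famB8OfRecordSubBH θ.toStage3Params lam.β lam.len j))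
    (P : B12.RunParams) : Dag.B8_main (leavesP w P) :=
  b8_main_of_isRecordOfRecord₁₃CSepCoPRSB8subBH_of_slot h (fun θ hP lam hθ hD hup => (b8LeafOfRecordSubBH_iff_subB_and_t8H lam).2 (hB θ hP lam hθ hD hup)) P

/-- RE-BINDING a `₁₃CSep` record's world by the S-binding over the [B8″H]-pinned view gives a record of this module with the SAME datum — the ∃-currency entry point (the [B8]
layer `lam`, e.g. the cut layer `λ.cutSubB J lan c₁`, is CHOSEN here). [cite: Balaban1989LargeFieldII, Thm 1 p.355 (bookkeeping)] -/
theorem isRecordOfRecord₁₃CSepCoPRSB8subBH_rebind_of_isRecordOfRecord₁₃CSepCoPR (h : IsRecordOfRecord₁₃CSepCoPR F N D w) :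
    ∃ (θ : Stage13RParams F N) (_ : θ.Provisos₁₃SepCoPR F N), θ.Admissible F N ∧ (∀ P, w.up P = upOfRecord₅C F N (θ.toStage5₁₃CoPR F N) P) ∧
      ∀ lam : ResidB8 θ.toStage3Params,
        IsRecordOfRecord₁₃CSepCoPRSB8subBH F N D { w with up := fun P => upOfRecord₅CS F N ((θ.pinB8SubBH F N lam).toStage5₁₃CoPR F N) P } := by
  obtain ⟨θ, hP, hθ, hD, hC, hγ, hL, hup⟩ := h
  exact ⟨θ, hP, hθ, hup, fun lam => ⟨θ, hP, lam, hθ, hD, hC, hγ, hL, fun _ => rfl⟩⟩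

/-- Every record of this module sits at a v1.6 datum of record presented by admissible separated-range parameters (projection). [cite: Balaban1989LargeFieldII, Thm 1 + (0.1) pp.355–356 (bookkeeping)] -/
theorem exists_provisos_of_isRecordOfRecord₁₃CSepCoPRSB8subBH (h : IsRecordOfRecord₁₃CSepCoPRSB8subBH F N D w) :
    ∃ (θ : Stage13RParams F N) (hP : θ.Provisos₁₃SepCoPR F N), θ.Admissible F N ∧ D = datumOfRecord₁₃SepCoPR F N θ hP := by
  obtain ⟨θ, hP, -, hθ, hD, -⟩ := h
  exact ⟨θ, hP, hθ, hD⟩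

end Record13SepCoPRB8subBH

#print axioms companion_of_isRecordOfRecord₁₃CSepCoPRSB8subBH
#print axioms b8_main_of_isRecordOfRecord₁₃CSepCoPRSB8subBH_of_subB_fields

end Literature.MathematicalPhysics.QuantumFieldTheory.Balaban1983to89.Node00

end
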